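import Summits.QuantumFields.BalabanUV.T4Continuum.Support.NE7K1LinTorusFloor
import Summits.QuantumFields.BalabanUV.T4Continuum.Support.NE7K1LinTwoRunFaces

/-!
# NE7K1LinTorusSymbolWindow — row NE7 (node U5), candidate route HOM, path H1L, cell K1-lin(s): B-E1's REAL-TORUS WINDOW,
# UPPER HALF — `T^𝕋(s) ⪯ (1 − s + sL)·n²(−Δ^𝕋_c)`, `σ_s(p) ≤ (1 − s + sL)·σ_NN(p)`; `σ_s(0) = 0`; `σ_s` AFFINE and
# NON-DECREASING in `s` (NEEDS-ESTIMATE #E1, B-E1's clause (c′), upper half of the window)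

Lineage `b2b-balaban-t4-ne7-p2` (CRUX PROVER NE7 #2), generation 73; file 41.  Files 38–40 gave: `σ_s(p)` real, even, base-point
free and Löwner-monotone (`NE7K1LinTorusSymbolReal`), the torus Jensen count (`NE7K1LinTorusJensen`) and the floor
`σ_NN(p) ≤ σ_s(p)` (`NE7K1LinTorusFloor`).  THIS FILE closes the two-sided window on the real torus and records the elementary
structure of `s ↦ σ_s`:

* §1 BLOCK-CONSTANT FIELDS on the fine torus: `T(V,0)(x) = V(blk x)` (`coordT_inl_apply`); a nearest neighbour lies in the same
  block or in the next one (`rblk_wrap_add_uvec`); THE FACE COUNT `Σ_x (V(blk(x+e_μ)) − V(blk x))² ≤ L^d·Σ_b (V(b+e_μ) − V(b))²`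
  (`fine_dirichlet_blockConst_le`: of the `L^{d+1}` offsets of a block exactly the `L^d` on the upper `μ`-face step out —
  `NE7K1LinTwoRunFaces.blk_finePt_add_uvec_of_lt ∕ _of_eq`, `card_offsets_fixed`).
* §2 **`schurC_torB_form_le`**: `⟨V, Schur(H_B^𝕋)V⟩ ≤ L·⟨V, n²(−Δ^𝕋_c)V⟩` (the Schur form is below the block-constant trial,
  `schur_form_le`) — with file 40 the torus twin of the box pair `P_A ⪯ P_B^{Schur} ⪯ L·P_A`; **`torLine_form_le`**:
  `⟨V, T^𝕋(s)V⟩ ≤ (1 − s + sL)·⟨V, n²(−Δ^𝕋_c)V⟩` for every `s ≥ 0`; on representatives `torLineRep_form_le`.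
* §3 THE SYMBOL: **`torSymb_re_le`** `σ_s(p) ≤ (1 − s + sL)·σ_NN(p)` (`s ≥ 0`) — with file 40's floor, THE WINDOW
  `σ_NN ≤ σ_s ≤ (1 − s + sL)σ_NN` on the real torus, uniformly in the mesh `n` and the torus `M`; **`torSymb_at_zero`**
  `σ_s(0) = 0` (`T^𝕋(s)·1 = 0`: `torLine_mulVec_one`); **`torSymb_affine`** `σ_s = (1−s)σ_0 + sσ_1` with `σ_0 = σ_NN`
  (`torSymb_zero_re`); **`torSymb_re_mono`**: `0 ≤ s ≤ t ⇒ σ_s(p) ≤ σ_t(p)` (the Löwner-monotone line, symbol level).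

HONEST FRAMING: [folklore] (finite linear algebra ∕ finite Fourier analysis); `a = 0`; the constant `L` is the block-constant
trial's (the box files' L-uniform `3(6∕5)^d` is not transported); no estimate of Bałaban's; no `sorry`.  Census only (B-E1's clause
(c′) on the finite doubled torus of every size; the STRIP clauses (b′)(e′) untouched — they need I3 on the torus); NE7 NOT
PRINTED ∕ NOT PROVED; spine 0∕9; FIXED FINITE T⁴, rung (B)+1; NOT infinite volume, NOT mass gap, NOT Clay.  HONEST DEPENDENCY:
continuum YM on T⁴ ⇐ BetaPertH ∧ nine spine estimates (0/9 proved); BetaPertH ⇐ (D1) ∧ (D4) ∧ CAP+tail; G-an2-4 gates asym,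
D1 and NE2/3/4.
-/

noncomputable section

open Finset Matrix Complex

namespace Summit.QuantumFields.BalabanUV.T4Continuum.NE7K1LinTorusSymbolWindow

open Literature.MathematicalPhysics.QuantumFieldTheory.Balaban1983to89
open Literature.MathematicalPhysics.QuantumFieldTheory.Balaban1983to89.B4Reflection242
open Literature.MathematicalPhysics.QuantumFieldTheory.Balaban1983to89.B4BoxCov237 (uvec)
open Literature.MathematicalPhysics.QuantumFieldTheory.Balaban1983to89.B4Lower18
open Literature.MathematicalPhysics.QuantumFieldTheory.Balaban1983to89.B4TorusPositivity (wrap wrap_wrap_add)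
open NE7K1LinFoldKernels NE7K1LinFoldMatrices NE7K1LinSchurFold NE7K1LinTorusChart NE7K1LinSchurFoldBox
  NE7K1LinTorusLineInvariant NE7K1LinTorusLineSymbol NE7K1LinTorusSymbolReal NE7K1LinTorusJensen NE7K1LinTorusFloor
  NE7K1LinBlockCoords NE7K1LinSchurLineU1 NE7K1LinSchurLineForm NE7K1LinTwoRunKit NE7K1LinWalkLine NE7K1LinSchurBilinError
open NE7K1LinTwoRunFaces (blk_finePt_add_uvec_of_lt blk_finePt_add_uvec_of_eq card_offsets_fixed)
open Literature.MathematicalPhysics.QuantumFieldTheory.Balaban1983to89.B4Green244 (finePt)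

variable {d : ℕ}

/-! ### §1 Block-constant fields on the fine torus and the crude face count -/

section BlockConst

variable {L : ℕ} [NeZero L] {K : Fin (d + 1) → ℕ} {T : Finset (Fin (d + 1) → ℤ)}

/-- **`T(V,0)` IS THE BLOCK-CONSTANT EXTENSION**: `(coordT (V,0))(x) = V(blk x)`. [folklore] -/
theorem coordT_inl_apply (hTL : IsBlockUnion L T) (V : ↥(T.image (blk L)) → ℝ) (x : ↥T) :
    (coordT hTL *ᵥ Sum.elim V 0) x = V (rblk L T x) := by
  obtain ⟨j, hj⟩ := rchart_surj NeZero.one_le hTL x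
  rw [← hj, coordT_mulVec_rchart, rblk_rchart]
  simp

/-- **A NEAREST NEIGHBOUR LIES IN THE SAME BLOCK OR IN THE NEXT ONE** (fine torus `(ℤ∕2LK)^{d+1}`, labels mod `2K`). [folklore] -/
theorem rblk_wrap_add_uvec (hK : ∀ i, 1 ≤ K i) (x : ↥(boxDom (dbl fun i => L * K i))) (μ : Fin (d + 1)) :
    rblk L _ ⟨wrap (dbl fun i => L * K i) (x.1 + uvec μ), wrap_mem_boxDom (fine_pos hK) _⟩ = rblk L _ x ∨
      rblk L _ ⟨wrap (dbl fun i => L * K i) (x.1 + uvec μ), wrap_mem_boxDom (fine_pos hK) _⟩ =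
        (⟨wrap (dbl K) ((rblk L _ x).1 + uvec μ), wrap_mem_labels hK _⟩ :
          ↥((boxDom (dbl fun i => L * K i)).image (blk L))) := by
  have hL : 1 ≤ L := NeZero.one_le
  have hval' : ∀ z : Fin (d + 1) → ℤ, blk L (wrap (dbl fun i => L * K i) z) = wrap (dbl K) (blk L z) := fun z => by
    rw [dbl_mul, blk_wrap hL (dbl_pos hK)]
  have hval := hval' (x.1 + uvec μ)
  have hbx : blk L x.1 ∈ boxDom (dbl K) := mem_dbl_of_label (Finset.mem_image_of_mem _ x.2)
  rcases blk_add_uvec hL x.1 μ with h | h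
  · left
    apply Subtype.ext
    show blk L (wrap (dbl fun i => L * K i) (x.1 + uvec μ)) = blk L x.1
    rw [hval, h, wrap_eq_self hbx]
  · right
    apply Subtype.ext
    show blk L (wrap (dbl fun i => L * K i) (x.1 + uvec μ)) = wrap (dbl K) (blk L x.1 + uvec μ)
    rw [hval, h]

/-- **THE FACE COUNT**: for a block-constant field the fine Dirichlet sum in direction `μ` is `L^d` times the coarse one — of the
`L^{d+1}` points of a block exactly the `L^d` on the upper `μ`-face step into the next block:
`Σ_x (V(blk(x + e_μ)) − V(blk x))² ≤ L^d·Σ_b (V(b + e_μ) − V(b))²`. [folklore] -/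
theorem fine_dirichlet_blockConst_le (hK : ∀ i, 1 ≤ K i) (V : ↥((boxDom (dbl fun i => L * K i)).image (blk L)) → ℝ)
    (μ : Fin (d + 1)) :
    ∑ x : ↥(boxDom (dbl fun i => L * K i)),
        (V (rblk L _ ⟨wrap (dbl fun i => L * K i) (x.1 + uvec μ), wrap_mem_boxDom (fine_pos hK) _⟩) - V (rblk L _ x)) ^ 2 ≤
      (L : ℝ) ^ d * ∑ b : ↥((boxDom (dbl fun i => L * K i)).image (blk L)),
        (V ⟨wrap (dbl K) (b.1 + uvec μ), wrap_mem_labels hK _⟩ - V b) ^ 2 := by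
  classical
  have hL : 1 ≤ L := NeZero.one_le
  have hTL : IsBlockUnion L (boxDom (dbl fun i => L * K i)) := by
    rw [dbl_mul]; exact boxDom_isBlockUnion hL _
  have hval : ∀ z : Fin (d + 1) → ℤ, blk L (wrap (dbl fun i => L * K i) z) = wrap (dbl K) (blk L z) := fun z => by
    rw [dbl_mul, blk_wrap hL (dbl_pos hK)]
  refine le_of_eq ?_
  rw [sum_eq_sum_blocks hTL, Finset.mul_sum]
  refine Finset.sum_congr rfl fun b _ => ?_
  have hb : b.1 ∈ boxDom (dbl K) := mem_dbl_of_label b.2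
  -- per offset: zero below the upper face, the coarse difference on it
  have hj : ∀ j : Fin (d + 1) → Fin L,
      (V (rblk L _ ⟨wrap (dbl fun i => L * K i) ((rchart hL hTL b j).1 + uvec μ), wrap_mem_boxDom (fine_pos hK) _⟩) -
          V (rblk L _ (rchart hL hTL b j))) ^ 2 =
        if (j μ : ℕ) + 1 = L then (V ⟨wrap (dbl K) (b.1 + uvec μ), wrap_mem_labels hK _⟩ - V b) ^ 2 else 0 := by
    intro j
    rw [rblk_rchart]
    have hlt : (j μ : ℕ) + 1 ≤ L := (j μ).2
    by_cases h : (j μ : ℕ) + 1 = L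
    · rw [if_pos h]
      have e : rblk L _ ⟨wrap (dbl fun i => L * K i) ((rchart hL hTL b j).1 + uvec μ), wrap_mem_boxDom (fine_pos hK) _⟩ =
          (⟨wrap (dbl K) (b.1 + uvec μ), wrap_mem_labels hK _⟩ : ↥((boxDom (dbl fun i => L * K i)).image (blk L))) := by
        apply Subtype.ext
        show blk L (wrap (dbl fun i => L * K i) (finePt L b.1 j + uvec μ)) = wrap (dbl K) (b.1 + uvec μ)
        rw [hval, blk_finePt_add_uvec_of_eq hL b.1 μ j h]
      rw [e]
    · rw [if_neg h]
      have e : rblk L _ ⟨wrap (dbl fun i => L * K i) ((rchart hL hTL b j).1 + uvec μ), wrap_mem_boxDom (fine_pos hK) _⟩ = b := by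
        apply Subtype.ext
        show blk L (wrap (dbl fun i => L * K i) (finePt L b.1 j + uvec μ)) = b.1
        rw [hval, blk_finePt_add_uvec_of_lt hL b.1 μ j (by omega), wrap_eq_self hb]
      rw [e, sub_self, zero_pow two_ne_zero]
  simp_rw [hj]
  rw [Finset.sum_ite, Finset.sum_const_zero, add_zero, Finset.sum_const, nsmul_eq_mul]
  -- the upper face has `L^d` offsets
  have hface : (Finset.univ.filter fun j : Fin (d + 1) → Fin L => (j μ : ℕ) + 1 = L) =
      Finset.univ.filter fun j : Fin (d + 1) → Fin L => j μ = ⟨L - 1, by omega⟩ := by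
    refine Finset.filter_congr fun j _ => ?_
    rw [Fin.ext_iff]
    constructor
    · intro h; show (j μ : ℕ) = L - 1; omega
    · intro h; have : (j μ : ℕ) = L - 1 := h; omega
  rw [hface, card_offsets_fixed μ ⟨L - 1, by omega⟩]
  push_cast
  ring

end BlockConst

/-! ### §2 The forms: `Schur(H_B^𝕋) ⪯ L²·n²(−Δ^𝕋_c)` and `T^𝕋(s) ⪯ (1 − s + sL²)·n²(−Δ^𝕋_c)` -/

section Forms

variable {n L : ℕ} [NeZero L] {K Nf : Fin (d + 1) → ℕ} {T : Finset (Fin (d + 1) → ℤ)}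

/-- the block-constant trial: `⟨(V,0), H_B^𝕋(V,0)⟩ ≤ L·⟨V, n²(−Δ^𝕋_c)V⟩` (`a = 0`; `L^{−(d+1)}·(nL)²·L^d = L·n²`). [folklore] -/
theorem torB_inl_form_le (hK : ∀ i, 1 ≤ K i) (hNf : Nf = fun i => L * K i) (hT : T = boxDom (dbl Nf))
    (hTL : IsBlockUnion L T) (V : ↥(T.image (blk L)) → ℝ) :
    Sum.elim V 0 ⬝ᵥ torB hTL n 0 Nf *ᵥ Sum.elim V 0 ≤
      (L : ℝ) * (V ⬝ᵥ torOpK n 0 K (T.image (blk L)) *ᵥ V) := by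
  subst hNf hT
  have hL : 1 ≤ L := NeZero.one_le
  have hLpos : (0 : ℝ) < L := by exact_mod_cast hL
  have hLpow : (0 : ℝ) < (L : ℝ) ^ (d + 1) := pow_pos hLpos _
  have hNf' : ∀ i, 1 ≤ (fun i => L * K i) i := mul_pos_side hL hK
  rw [torB, form_chartOp, torOpK_zero_form n hK (image_blk_dbl hL K) V, torOpK_zero_form (n * L) hNf' rfl _]
  simp only [coordT_inl_apply]
  have hF := fun μ => fine_dirichlet_blockConst_le hK V μ
  have hsum : ∑ μ : Fin (d + 1), ∑ x : ↥(boxDom (dbl fun i => L * K i)),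
      (V (rblk L _ ⟨wrap (dbl fun i => L * K i) (x.1 + uvec μ), wrap_mem_boxDom (fine_pos hK) _⟩) - V (rblk L _ x)) ^ 2 ≤
        (L : ℝ) ^ d * ∑ μ : Fin (d + 1), ∑ b : ↥((boxDom (dbl fun i => L * K i)).image (blk L)),
          (V ⟨wrap (dbl K) (b.1 + uvec μ), wrap_mem_labels hK _⟩ - V b) ^ 2 := by
    rw [Finset.mul_sum]
    exact Finset.sum_le_sum fun μ _ => hF μ
  set C := ∑ μ : Fin (d + 1), ∑ b : ↥((boxDom (dbl fun i => L * K i)).image (blk L)),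
    (V ⟨wrap (dbl K) (b.1 + uvec μ), wrap_mem_labels hK _⟩ - V b) ^ 2 with hC
  have hCn : 0 ≤ C := Finset.sum_nonneg fun _ _ => Finset.sum_nonneg fun _ _ => sq_nonneg _
  have h1 : ((L : ℝ) ^ (d + 1))⁻¹ * (((n * L : ℕ) : ℝ) ^ 2 * ((L : ℝ) ^ d * C)) = (L : ℝ) * ((n : ℝ) ^ 2 * C) := by
    push_cast
    field_simp
    ring
  calc ((L : ℝ) ^ (d + 1))⁻¹ * (((n * L : ℕ) : ℝ) ^ 2 * ∑ μ : Fin (d + 1), ∑ x : ↥(boxDom (dbl fun i => L * K i)),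
        (V (rblk L _ ⟨wrap (dbl fun i => L * K i) (x.1 + uvec μ), wrap_mem_boxDom (fine_pos hK) _⟩) - V (rblk L _ x)) ^ 2)
      ≤ ((L : ℝ) ^ (d + 1))⁻¹ * (((n * L : ℕ) : ℝ) ^ 2 * ((L : ℝ) ^ d * C)) :=
        mul_le_mul_of_nonneg_left (mul_le_mul_of_nonneg_left hsum (sq_nonneg _)) (inv_nonneg.2 hLpow.le)
    _ = (L : ℝ) * ((n : ℝ) ^ 2 * C) := h1

/-- the fluctuation block of `H_B^𝕋` is a non-negative form (domination + run B's floor). [folklore] -/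
theorem torB_fluct_psd (hn : 1 ≤ n) (hT' : IsBlockUnion (n * L) T) (hT : T = boxDom (dbl Nf)) (hNf : ∀ i, 1 ≤ Nf i)
    (ψ : ↥(T.image (blk L)) × NZ d L → ℝ) : 0 ≤ ψ ⬝ᵥ (torB (isBlockUnion_fine hT') n 0 Nf).toBlocks₂₂ *ᵥ ψ := by
  have hn0 : (0 : ℝ) < n := by exact_mod_cast hn
  have hL0 : (0 : ℝ) < L := by exact_mod_cast (NeZero.one_le : 1 ≤ L)
  rw [← form_inr]
  refine le_trans ?_ ((runB_form_ge_fluct hn hT' le_rfl 0 ψ).trans (torB_form_ge hT' hT hNf 0 _))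
  exact mul_nonneg (div_nonneg (mul_nonneg two_pos.le (sq_nonneg _)) (pow_nonneg hL0.le _))
    (Finset.sum_nonneg fun _ _ => mul_self_nonneg _)

/-- **(K2)♯ ON THE TORUS, UPPER HALF: `Schur(H_B^𝕋) ⪯ L·n²(−Δ^𝕋_c)`** (`a = 0`): the hard Schur complement is below the
block-constant trial — the torus twin of `NE7K1LinTwoRunFaces.schurB_form_le_sharp`. [folklore] -/
theorem schurC_torB_form_le (hn : 1 ≤ n) (hK : ∀ i, 1 ≤ K i) (hNf : Nf = fun i => L * K i)
    (hT : T = boxDom (dbl Nf)) (hT' : IsBlockUnion (n * L) T) (V : ↥(T.image (blk L)) → ℝ) :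
    V ⬝ᵥ schurC (torB (isBlockUnion_fine hT') n 0 Nf) *ᵥ V ≤ (L : ℝ) * (V ⬝ᵥ torOpK n 0 K (T.image (blk L)) *ᵥ V) := by
  have hNf' : ∀ i, 1 ≤ Nf i := by subst hNf; exact mul_pos_side (NeZero.one_le : 1 ≤ L) hK
  set H := torB (isBlockUnion_fine hT') n 0 Nf with hH
  have hsymm : H.IsSymm := torB_isSymm (isBlockUnion_fine hT') hT n 0
  have hblocks := (Matrix.isSymm_fromBlocks_iff.1 (by rw [fromBlocks_toBlocks H]; exact hsymm))
  have hDu : IsUnit (H.toBlocks₂₂).det := isUnit_det_torB_fluct hn hT' hT hNf' le_rfl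
  have h := schur_form_le H.toBlocks₁₁ H.toBlocks₁₂ H.toBlocks₂₁ H.toBlocks₂₂ hblocks.2.1 hblocks.2.2.2 hDu
    (torB_fluct_psd hn hT' hT hNf') V 0
  rw [fromBlocks_toBlocks] at h
  exact h.trans (torB_inl_form_le hK hNf hT (isBlockUnion_fine hT') V)

/-- **`T^𝕋(s) ⪯ (1 − s + sL)·n²(−Δ^𝕋_c)` for every `s ≥ 0`** (`a = 0`). [folklore] -/
theorem torLine_form_le (hn : 1 ≤ n) (hK : ∀ i, 1 ≤ K i) (hNf : Nf = fun i => L * K i)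
    (hT : T = boxDom (dbl Nf)) (hT' : IsBlockUnion (n * L) T) {s : ℝ} (hs0 : 0 ≤ s) (V : ↥(T.image (blk L)) → ℝ) :
    V ⬝ᵥ torLine (isBlockUnion_fine hT') n 0 Nf K s *ᵥ V ≤
      (1 - s + s * (L : ℝ)) * (V ⬝ᵥ torOpK n 0 K (T.image (blk L)) *ᵥ V) := by
  have h1 := schurC_torB_form_le hn hK hNf hT hT' V
  unfold torLine
  rw [lineOpR_eq_schurC, add_mulVec, smul_mulVec, smul_mulVec, dotProduct_add, dotProduct_smul,
    dotProduct_smul, smul_eq_mul, smul_eq_mul]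
  nlinarith [mul_le_mul_of_nonneg_left h1 hs0]

variable {M : Fin (d + 1) → ℕ}

/-- **ON REPRESENTATIVES: `T^𝕋(s) ⪯ (1 − s + sL)·n²(−Δ^𝕋)`** for `s ≥ 0`. [folklore] -/
theorem torLineRep_form_le (hn : 1 ≤ n) (hM : ∀ i, 1 ≤ M i) {s : ℝ} (hs0 : 0 ≤ s)
    (φ : ↥(boxDom (dbl fun i => n * M i)) → ℝ) :
    φ ⬝ᵥ torLineRep (L := L) hn M s *ᵥ φ ≤
      (1 - s + s * (L : ℝ)) * (φ ⬝ᵥ torOpK n 0 (fun i => n * M i) (boxDom (dbl fun i => n * M i)) *ᵥ φ) := by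
  obtain ⟨V, h1, h2⟩ := forms_transport (L := L) hn s φ
  rw [h1, h2]
  exact torLine_form_le (n := n) (L := L) (K := fun i => n * M i) (Nf := fun i => n * L * M i)
    (T := boxDom (dbl fun i => n * L * M i)) hn (mul_pos_side hn hM) (side_eq n L M) rfl
    (fineTor_isBlockUnion hn NeZero.one_le M) hs0 V

end Forms

/-! ### §3 The symbol: the upper half of the window, `σ_s(0) = 0`, affine and non-decreasing in `s` -/

section Symbol

variable {n L : ℕ} [NeZero L] {M : Fin (d + 1) → ℕ}

/-- the symbol is linear in the matrix: `symb(c·X) = c·symb X`. [folklore] -/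
theorem symbT_smul {P : Fin (d + 1) → ℕ} (c : ℝ) (X : Matrix ↥(boxDom P) ↥(boxDom P) ℝ) (y₀ : ↥(boxDom P))
    (p : Fin (d + 1) → ℤ) : symbT P (c • X) y₀ p = (c : ℂ) * symbT P X y₀ p := by
  unfold symbT
  rw [Finset.mul_sum]
  refine Finset.sum_congr rfl fun y _ => ?_
  rw [Matrix.smul_apply, smul_eq_mul]
  push_cast
  ring

/-- **B-E1 (c′), UPPER HALF OF THE WINDOW ON THE REAL TORUS: `σ_s(p) ≤ (1 − s + sL)·σ_NN(p)`** for every `s ≥ 0`, mesh `n`, `L`,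
torus `M` and dual index `p` (`a = 0`). [folklore] -/
theorem torSymb_re_le (hn : 1 ≤ n) (hM : ∀ i, 1 ≤ M i) {s : ℝ} (hs0 : 0 ≤ s) (y₀ : ↥(boxDom (dbl fun i => n * M i)))
    (p : Fin (d + 1) → ℤ) :
    (torSymb (L := L) hn M s y₀ p).re ≤
      (1 - s + s * (L : ℝ)) * ((n : ℝ) ^ 2 *
        ∑ μ : Fin (d + 1), (2 - 2 * Real.cos (2 * Real.pi * p μ / (dbl (fun i => n * M i) μ : ℝ)))) := by
  have hN := mul_pos_side hn hM
  set c : ℝ := 1 - s + s * (L : ℝ) with hc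
  have h := torSymb_re_le_symbT_re hn hM s (c • torOpK n 0 (fun i => n * M i) (boxDom (dbl fun i => n * M i)))
    ((torOpK_isSymm n 0 _ rfl).smul c)
    (fun v x y => by rw [Matrix.smul_apply, Matrix.smul_apply, torOpK_zero_transl_apply n hN v x y])
    (fun φ => by rw [smul_mulVec, dotProduct_smul, smul_eq_mul]; exact torLineRep_form_le hn hM hs0 φ) y₀ p
  rw [symbT_smul, Complex.re_ofReal_mul, symbT_torOpK_zero_re n hN y₀ p] at h
  exact h

/-- the periodic operator at `a = 0` kills constants. [folklore] -/
theorem torOpK_zero_mulVec_one (n : ℕ) {N : Fin (d + 1) → ℕ} (hN : ∀ i, 1 ≤ N i) {F : Finset (Fin (d + 1) → ℤ)}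
    (hF : F = boxDom (dbl N)) : torOpK n 0 N F *ᵥ (fun _ => (1 : ℝ)) = 0 := by
  subst hF
  ext x
  simp only [mulVec, dotProduct, torOpK_apply, mul_one, zero_mul, ite_self, add_zero, Pi.zero_apply]
  rw [← Finset.mul_sum, Finset.sum_sub_distrib, Finset.sum_ite_eq, if_pos (Finset.mem_univ _), sum_tadj_real hN x]
  ring

variable {K Nf : Fin (d + 1) → ℕ} {T : Finset (Fin (d + 1) → ℤ)}

/-- **`T^𝕋(s)·1 = 0`**: the torus line kills constants at `a = 0` (run A's periodic operator does, and `H_B^𝕋(1,0) = 0` forces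
`Schur(H_B^𝕋)·1 = 0`). [folklore] -/
theorem torLine_mulVec_one (hK : ∀ i, 1 ≤ K i) (hNf : Nf = fun i => L * K i) (hT : T = boxDom (dbl Nf))
    (hTL : IsBlockUnion L T) (s : ℝ) : torLine hTL n 0 Nf K s *ᵥ (fun _ => (1 : ℝ)) = 0 := by
  subst hNf hT
  have hL : 1 ≤ L := NeZero.one_le
  have hNf' : ∀ i, 1 ≤ (fun i => L * K i) i := mul_pos_side hL hK
  set H := torB hTL n 0 (fun i => L * K i) with hH
  -- `H(1,0) = 0`
  have hT1 : coordT hTL *ᵥ Sum.elim (fun _ => (1 : ℝ)) 0 = fun _ => 1 := by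
    ext x; rw [coordT_inl_apply]
  have hH10 : H *ᵥ Sum.elim (fun _ => (1 : ℝ)) 0 = 0 := by
    rw [hH, torB, chartOp_mulVec, hT1, torOpK_zero_mulVec_one (n * L) hNf' rfl, mulVec_zero, smul_zero]
  have hblk : H.toBlocks₁₁ *ᵥ (fun _ => (1 : ℝ)) = 0 ∧ H.toBlocks₂₁ *ᵥ (fun _ => (1 : ℝ)) = 0 := by
    have h := hH10
    conv_lhs at h => rw [← fromBlocks_toBlocks H]
    rw [fromBlocks_mulVec, Sum.elim_comp_inl, Sum.elim_comp_inr, mulVec_zero, mulVec_zero, add_zero, add_zero] at h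
    constructor
    · ext b; have := congrFun h (Sum.inl b); simpa using this
    · ext c; have := congrFun h (Sum.inr c); simpa using this
  unfold torLine
  rw [lineOpR_eq_schurC, add_mulVec, smul_mulVec, smul_mulVec, torOpK_zero_mulVec_one n hK (image_blk_dbl hL K),
    schurC, sub_mulVec, hblk.1, Matrix.mul_assoc, ← mulVec_mulVec, ← mulVec_mulVec, hblk.2, mulVec_zero, mulVec_zero,
    sub_zero, smul_zero, smul_zero, add_zero]

/-- **B-E1: `σ_s(0) = 0`** — the symbol vanishes at zero momentum (the line kills constants). [folklore] -/
theorem torSymb_at_zero (hn : 1 ≤ n) (hM : ∀ i, 1 ≤ M i) (s : ℝ) (y₀ : ↥(boxDom (dbl fun i => n * M i))) :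
    torSymb (L := L) hn M s y₀ 0 = 0 := by
  have hL : 1 ≤ L := NeZero.one_le
  have h1 := torLine_mulVec_one (n := n) (K := fun i => n * M i) (Nf := fun i => n * L * M i)
    (T := boxDom (dbl fun i => n * L * M i)) (mul_pos_side hn hM) (side_eq n L M) rfl
    (isBlockUnion_fine (fineTor_isBlockUnion hn hL M)) s
  have h2 := congrFun h1 ⟨y₀.1, mem_image_of_mem_dbl (L := L) y₀.2⟩
  simp only [mulVec, dotProduct, mul_one, Pi.zero_apply] at h2
  unfold torSymb symbT
  have hchi : ∀ z : Fin (d + 1) → ℤ, chiT (dbl fun i => n * M i) 0 z = 1 := fun z => by simp [chiT]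
  simp_rw [hchi, mul_one]
  rw [← Complex.ofReal_sum]
  -- the row sum on representatives is the row sum on the label set
  have e : ∑ y : ↥(boxDom (dbl fun i => n * M i)), torLineRep (L := L) hn M s y₀ y =
      ∑ y : ↥((boxDom (dbl fun i => n * L * M i)).image (blk L)),
        torLine (isBlockUnion_fine (fineTor_isBlockUnion hn hL M)) n 0 (fun i => n * L * M i) (fun i => n * M i) s
          ⟨y₀.1, mem_image_of_mem_dbl (L := L) y₀.2⟩ y := by
    refine Fintype.sum_equiv
      { toFun := fun x => ⟨x.1, mem_image_of_mem_dbl (L := L) x.2⟩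
        invFun := fun y => ⟨y.1, mem_dbl_of_mem_image (L := L) y.2⟩
        left_inv := fun x => Subtype.ext rfl
        right_inv := fun y => Subtype.ext rfl } _ _ fun x => rfl
  rw [e, h2, Complex.ofReal_zero]

/-- at `s = 0` the torus line is run A's periodic operator. [folklore] -/
theorem torLine_at_zero {a : ℝ} (hTL : IsBlockUnion L T) : torLine hTL n a Nf K 0 = torOpK n a K (T.image (blk L)) := by
  unfold torLine lineOpR
  simp

/-- the torus line is AFFINE in `s`: `T^𝕋(s) = (1−s)·T^𝕋(0) + s·T^𝕋(1)`. [folklore] -/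
theorem torLine_affine {a : ℝ} (hTL : IsBlockUnion L T) (s : ℝ) :
    torLine hTL n a Nf K s = (1 - s) • torLine hTL n a Nf K 0 + s • torLine hTL n a Nf K 1 := by
  unfold torLine lineOpR
  ext x y
  simp only [Matrix.add_apply, Matrix.smul_apply, smul_eq_mul]
  ring

/-- **`σ_0 = σ_NN`**: at `s = 0` the symbol is the periodic nearest-neighbour symbol `n²·Σ_μ (2 − 2cos(2πp_μ∕2nM_μ))`.
[folklore] -/
theorem torSymb_zero_re (hn : 1 ≤ n) (hM : ∀ i, 1 ≤ M i) (y₀ : ↥(boxDom (dbl fun i => n * M i))) (p : Fin (d + 1) → ℤ) :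
    (torSymb (L := L) hn M 0 y₀ p).re =
      (n : ℝ) ^ 2 * ∑ μ : Fin (d + 1), (2 - 2 * Real.cos (2 * Real.pi * p μ / (dbl (fun i => n * M i) μ : ℝ))) := by
  rw [← symbT_torOpK_zero_re n (mul_pos_side hn hM) y₀ p]
  unfold torSymb
  congr 2
  ext x y
  unfold torLineRep
  rw [torLine_at_zero, torOpK_apply, torOpK_apply]
  simp only [Subtype.ext_iff, zero_mul, ite_self, add_zero]

/-- **THE SYMBOL IS AFFINE IN `s`: `σ_s(p) = (1−s)·σ_0(p) + s·σ_1(p)`.** [folklore] -/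
theorem torSymb_affine (hn : 1 ≤ n) (M : Fin (d + 1) → ℕ) (s : ℝ) (y₀ : ↥(boxDom (dbl fun i => n * M i)))
    (p : Fin (d + 1) → ℤ) :
    torSymb (L := L) hn M s y₀ p =
      ((1 - s : ℝ) : ℂ) * torSymb (L := L) hn M 0 y₀ p + (s : ℂ) * torSymb (L := L) hn M 1 y₀ p := by
  unfold torSymb symbT
  rw [Finset.mul_sum, Finset.mul_sum, ← Finset.sum_add_distrib]
  refine Finset.sum_congr rfl fun y _ => ?_
  have e : torLineRep (L := L) hn M s y₀ y = (1 - s) * torLineRep (L := L) hn M 0 y₀ y + s * torLineRep (L := L) hn M 1 y₀ y := by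
    unfold torLineRep
    rw [torLine_affine _ s, Matrix.add_apply, Matrix.smul_apply, Matrix.smul_apply, smul_eq_mul, smul_eq_mul]
  rw [e]
  push_cast
  ring

/-- **THE SYMBOL IS NON-DECREASING IN `s`** (the Löwner-monotone line at symbol level): `0 ≤ s ≤ t ⇒ σ_s(p) ≤ σ_t(p)`. [folklore] -/
theorem torSymb_re_mono (hn : 1 ≤ n) (hM : ∀ i, 1 ≤ M i) {s t : ℝ} (hst : s ≤ t)
    (y₀ : ↥(boxDom (dbl fun i => n * M i))) (p : Fin (d + 1) → ℤ) :
    (torSymb (L := L) hn M s y₀ p).re ≤ (torSymb (L := L) hn M t y₀ p).re := by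
  have h1 : (torSymb (L := L) hn M 0 y₀ p).re ≤ (torSymb (L := L) hn M 1 y₀ p).re := by
    rw [torSymb_zero_re hn hM y₀ p]
    exact torSymb_re_ge_nn hn hM zero_le_one y₀ p
  rw [torSymb_affine hn M s y₀ p, torSymb_affine hn M t y₀ p]
  simp only [Complex.add_re, Complex.re_ofReal_mul]
  nlinarith [mul_le_mul_of_nonneg_right hst (sub_nonneg.2 h1)]

/-- **B-E1 (c′): THE TWO-SIDED WINDOW ON THE REAL TORUS**, both halves in one statement:
`σ_NN(p) ≤ σ_s(p) ≤ (1 − s + sL)·σ_NN(p)` for `s ≥ 0` (uniformly in the mesh `n` and the torus `M`) — lens 2's window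
`k̃_L∕NN ∈ [1, L]` at `s = 1`, every `p`, on every finite doubled torus. [folklore] -/
theorem torSymb_window (hn : 1 ≤ n) (hM : ∀ i, 1 ≤ M i) {s : ℝ} (hs0 : 0 ≤ s) (y₀ : ↥(boxDom (dbl fun i => n * M i)))
    (p : Fin (d + 1) → ℤ) :
    (n : ℝ) ^ 2 * ∑ μ : Fin (d + 1), (2 - 2 * Real.cos (2 * Real.pi * p μ / (dbl (fun i => n * M i) μ : ℝ))) ≤
        (torSymb (L := L) hn M s y₀ p).re ∧
      (torSymb (L := L) hn M s y₀ p).re ≤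
        (1 - s + s * (L : ℝ)) * ((n : ℝ) ^ 2 *
          ∑ μ : Fin (d + 1), (2 - 2 * Real.cos (2 * Real.pi * p μ / (dbl (fun i => n * M i) μ : ℝ)))) :=
  ⟨torSymb_re_ge_nn hn hM hs0 y₀ p, torSymb_re_le hn hM hs0 y₀ p⟩

end Symbol

end Summit.QuantumFields.BalabanUV.T4Continuum.NE7K1LinTorusSymbolWindow

end
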